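import Summits.Ventures.HSemireg.WedgeHankelGlue

/-!
# Venture HSemireg — the Weil-frame purity locus (1/3): Weil-side products and the two-exponential h-part

HONEST FRAMING. Part of the Lean index of the computation cell `pub-hsemireg` (second enclosure wave, cut by seat p6 in the
conventions of seat p3's ENCLOSURE-PLAN-p3.md / build.py from th-7's kernel assets).  Finite-dimensional exterior algebra over a field ONLY:
no variety, no cohomology theory, no semiregularity map is constructed here; nothing here says that HC / HC_CM / HC_AV holds;
no Literature fact is declared or used.  The geometric DICTIONARY (why these ranks are the `HT`-side box ranks of the cell's
STRUCTURE.md §1 / theory/FORMULA-N.md) lives in theory/FORMULA-N-th7.md PART B §A.3 / §N and is NOT asserted in Lean.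

th-7's PART W — THE WEIL-FRAME PURITY LOCUS: transport of PART V (`WedgeBoxPurityRank.lean`) to WeilRank's model (theory/th7/WeilPurity.lean v3.2 sha256/16 fa4f1543e639b652 (th-7 g5, 22:21Z 2026-08-22; ×2 farm rc 0 + axioms standard at p3 g9 21:58Z (v3.1 prefix), th-2 g22 22:27Z, p6 g7 22:32Z; statement reads + independent exact numerics p6 g6 X2-WEILPURITY-p6g6.md a0873432c5a1b400 (PART W 105/105, PART D 704/704) and p6 g7 X2-WEILPURITY-E-p6g7.md 6348f244af71037e (PART E 216/216)),
l.5951–6117), VERBATIM up to namespaces (`HSemiregWeilPurity` ↦ `Summit.Ventures.HSemireg.Wedge.WeilPurity`, which sees `….Wedge` and opens `….Wedge.Hankel`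
HIDING the th-6-glue names `Φ` / `isoQ` / `Φ_ι` of `WedgeHankelGlue.lean` — PART W's own `Φ` / `isoQ` / `Φ_ι` (the change of generators below) keep th-7's
printed names; `HSemiregBox.` ↦ `Summit.Ventures.HSemireg.WedgeBox.`, `HSemiregWeil` ↦ `….Wedge.Weil`), file 1 of 3.
MODEL / THEOREM (file 3, `weilPurity`, `weilPurity_vW`): in the wedge model of Weil type `(n,n)` (`N = n + n` pairs `x_c, y_c`; h-part `w_N(q)`) with the
two-exponential h-part `q_k = c₁λ^k + c₂μ^k` (`λ ≠ μ`) and `v = w_N(q) + a·Π_{c≥n}(x_c∧y_c) + b·Π_{c<n}(x_c∧y_c)` (resp. WeilRank's own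
`vW = w_N(q) + a·E_{Gm} + b·E_{Dm}`), `c₁c₂ab ≠ 0`, every field, every `n ≥ 1`: `rank(θ ↦ θ ∧ v ∣ ⋀ⁿ) + 4 + 2·[ab = c₁c₂(λ−μ)^{2n}] = 4·C(2n,n)`
(FORMULA-N PART B §L.5, STRUCTURE C16; `n = 2`: `18 ∣ 20`, T4a's (I2-β)).  Route: the change of generators `A0 = (x_c+λy_c)_{c≥n}`, `A1 = (x_c+μy_c)_{c<n}`,
`C0 = (x_c+λy_c)_{c<n}`, `C1 = (x_c+μy_c)_{c≥n}` is a linear equivalence; the induced isomorphism of exterior algebras carries PART V's `hbox c`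
(`c₀₀ = (−1)^{n·n}c₁`, `c₁₁ = c₂`, `c₀₁ = a/((−1)^{C(n,2)}(μ−λ)ⁿ)`, `c₁₀ = b/((−1)^{C(n,2)}(λ−μ)ⁿ)`) to `v` and `⋀ⁿ` to `⋀ⁿ`, and `det c = 0 ⟺ ab = c₁c₂(λ−μ)^{2n}`.
Sign-free (parities only).  This file (Weil side): the ordered products `gq t s m = Π(x_c + t·y_c)`, `pp s m = Π(x_c ∧ y_c)`, their `Hom`-membership and commutation parities, and `w_N` of the two-exponential sequence as `c₁·gq λ + c₂·gq μ` (`w_two_exp`).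
-/

/-! ## PART W (th-7 g5, 2026-08-22 evening): THE WEIL-FRAME PURITY LOCUS — transport of PART V to WeilRank's model.

In WeilRank's wedge model of the Weil type `(n,n)` (`N = n + n` pairs `x_c, y_c`; h-part `w_N(q)`; Weil blocks on the
first `n` / last `n` pairs) take the two-exponential h-part `q_k = c₁λ^k + c₂μ^k` (`λ ≠ μ`), i.e.
`w_N(q) = c₁·Π_c(x_c + λy_c) + c₂·Π_c(x_c + μy_c)`, and the block volume forms in their pair-product normalisation
`Π_{c<n}(x_c ∧ y_c)`, `Π_{c≥n}(x_c ∧ y_c)` (= `ω^n/n!` on each block; these are `(−1)^{C(n,2)}`·WeilRank's `E_{Dm}`, `E_{Gm}`).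
THEOREM (`weilPurity`): for `v = w_N(q) + a·Π_{c≥n}(x_c∧y_c) + b·Π_{c<n}(x_c∧y_c)`, `c₁c₂ab ≠ 0`, every field, every
`n ≥ 1`: `rank(θ ↦ θ ∧ v on ⋀ⁿ) + 4 + 2·[ab = c₁c₂(λ−μ)^{2n}] = 4·C(2n,n)` — FORMULA-N PART B §L.5's PURITY-LOCUS LAW
(the degree `m = n` that THEOREM R-B / `weilRank_nn_deg` excludes; `n = 2`: `18 ∣ 20`, T4a's `(I2-β)`).
Route: the change of generators `A0 = (x_c+λy_c)_{c≥n}, A1 = (x_c+μy_c)_{c<n}, C0 = (x_c+λy_c)_{c<n}, C1 = (x_c+μy_c)_{c≥n}`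
is a linear equivalence `K^{4n} ≃ K^{2N}`; the induced isomorphism of exterior algebras carries PART V's honest box
`hbox c` (with `c₀₀ = (−1)^{n·n}c₁`, `c₁₁ = c₂`, `c₀₁ = a/((−1)^{C(n,2)}(μ−λ)ⁿ)`, `c₁₀ = b/((−1)^{C(n,2)}(λ−μ)ⁿ)`) to `v`
and `⋀ⁿ` to `⋀ⁿ`, and `det c = 0 ⟺ ab = c₁c₂(λ−μ)^{2n}`. Sign-free: only the parities `(−1)^m` of moving a generator past
`m` generators and `C(m+1,2) = C(m,2) + m` are used. -/

namespace Summit.Ventures.HSemireg.Wedge.WeilPurity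

open Module Set Set.powersetCard
open Summit.Ventures.HSemireg.Wedge.Hankel hiding Φ isoQ Φ_ι

variable (K : Type*) [Field K] (n : ℕ)

/-! ### Weil side: linear generators, their ordered products, pair products -/

/-- `Π_{c=s}^{s+m-1} (x_c + t·y_c)` (ordered). -/
noncomputable def gq (t : K) (s : ℕ) : ℕ → HT K (In (n + n))
  | 0 => 1
  | m + 1 => gq t s m * (X K (n + n) (s + m) + t • Y K (n + n) (s + m))

/-- `Π_{c=s}^{s+m-1} (x_c ∧ y_c)` (ordered; the factors are even and commute). -/
noncomputable def pp (s : ℕ) : ℕ → HT K (In (n + n))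
  | 0 => 1
  | m + 1 => pp s m * (X K (n + n) (s + m) * Y K (n + n) (s + m))

variable {n}

/-- `x_c + t·y_c` is the image of a vector under `ι` (junk-compatible). -/
lemma lin_eq_ι (c : ℕ) (t : K) :
    ∃ v : In (n + n) → K, X K (n + n) c + t • Y K (n + n) c = ExteriorAlgebra.ι K v := by
  by_cases h : c < n + n
  · refine ⟨b K (In (n + n)) (xI c h) + t • b K (In (n + n)) (yI c h), ?_⟩
    rw [X, Y, dif_pos h, dif_pos h, gx_eq_ι, gx_eq_ι, map_add, map_smul]
  · refine ⟨0, ?_⟩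
    rw [X, Y, dif_neg h, dif_neg h, smul_zero, add_zero, map_zero]

/-- `x_c ∧ x_c = 0`. -/
lemma XX (c : ℕ) : X K (n + n) c * X K (n + n) c = 0 := by
  by_cases h : c < n + n
  · rw [X, dif_pos h, gx_mul_self]
  · rw [X, dif_neg h, mul_zero]

/-- `y_c ∧ y_c = 0`. -/
lemma YY (c : ℕ) : Y K (n + n) c * Y K (n + n) c = 0 := by
  by_cases h : c < n + n
  · rw [Y, dif_pos h, gx_mul_self]
  · rw [Y, dif_neg h, mul_zero]

/-- `y_c ∧ x_c = −(x_c ∧ y_c)`. -/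
lemma YX (c : ℕ) : Y K (n + n) c * X K (n + n) c = -(X K (n + n) c * Y K (n + n) c) := by
  by_cases h : c < n + n
  · rw [X, Y, dif_pos h, dif_pos h, gy_mul_gx]
  · rw [X, dif_neg h, mul_zero, zero_mul, neg_zero]

/-- `(x + t y)(x + t' y) = (t' − t)·(x ∧ y)`. -/
lemma lin_mul_lin (c : ℕ) (t t' : K) :
    (X K (n + n) c + t • Y K (n + n) c) * (X K (n + n) c + t' • Y K (n + n) c) =
      (t' - t) • (X K (n + n) c * Y K (n + n) c) := by
  simp only [add_mul, mul_add, smul_mul_assoc, mul_smul_comm, XX, YY, YX, smul_zero, zero_add, add_zero, smul_neg]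
  rw [sub_smul]
  abel

/-- two linear elements anticommute. -/
lemma lin_anticomm (c c' : ℕ) (t t' : K) :
    (X K (n + n) c + t • Y K (n + n) c) * (X K (n + n) c' + t' • Y K (n + n) c') =
      -((X K (n + n) c' + t' • Y K (n + n) c') * (X K (n + n) c + t • Y K (n + n) c)) := by
  obtain ⟨v, hv⟩ := lin_eq_ι K (n := n) c t
  obtain ⟨v', hv'⟩ := lin_eq_ι K (n := n) c' t'
  rw [hv, hv']
  exact eq_neg_of_add_eq_zero_left (ExteriorAlgebra.ι_add_mul_swap v v')

/-- a linear element passes a product of `m` linear elements with sign `(−1)^m`. -/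
lemma lin_mul_gq (c : ℕ) (t t' : K) (s : ℕ) : ∀ m : ℕ,
    (X K (n + n) c + t • Y K (n + n) c) * gq K n t' s m =
      ((-1 : K) ^ m) • (gq K n t' s m * (X K (n + n) c + t • Y K (n + n) c))
  | 0 => by rw [gq, mul_one, one_mul, pow_zero, one_smul]
  | m + 1 => by
    rw [gq, ← mul_assoc, lin_mul_gq c t t' s m, smul_mul_assoc, mul_assoc, lin_anticomm K c, mul_neg,
      mul_assoc, smul_neg, pow_succ, mul_neg_one, neg_smul]

/-- `Π(x_c + t y_c) · Π(x_c + t' y_c)` over the same block = `(−1)^{C(m,2)} (t' − t)^m · Π(x_c ∧ y_c)`. -/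
lemma gq_mul_gq_same (t t' : K) (s : ℕ) : ∀ m : ℕ,
    gq K n t s m * gq K n t' s m = (((-1 : K) ^ (m.choose 2)) * (t' - t) ^ m) • pp K n s m
  | 0 => by rw [gq, gq, pp, mul_one, Nat.choose_zero_succ, pow_zero, pow_zero, mul_one, one_smul]
  | m + 1 => by
    have ih := gq_mul_gq_same t t' s m
    rw [gq, gq, pp]
    have h1 : gq K n t s m * (X K (n + n) (s + m) + t • Y K (n + n) (s + m)) *
        (gq K n t' s m * (X K (n + n) (s + m) + t' • Y K (n + n) (s + m))) =
        ((-1 : K) ^ m) • ((gq K n t s m * gq K n t' s m) *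
          ((X K (n + n) (s + m) + t • Y K (n + n) (s + m)) * (X K (n + n) (s + m) + t' • Y K (n + n) (s + m)))) := by
      rw [mul_assoc, ← mul_assoc (X K (n + n) (s + m) + t • Y K (n + n) (s + m)), lin_mul_gq, smul_mul_assoc,
        mul_smul_comm, mul_assoc (gq K n t' s m), ← mul_assoc (gq K n t s m)]
    rw [h1, lin_mul_lin, ih, smul_mul_assoc, mul_smul_comm, smul_smul, smul_smul]
    congr 1
    rw [Nat.choose_succ_succ', Nat.choose_one_right, pow_add, pow_succ]
    ring

/-- graded commutativity of two products of linear elements. -/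
lemma gq_mul_gq_comm (t t' : K) (s s' m' : ℕ) : ∀ m : ℕ,
    gq K n t s m * gq K n t' s' m' = ((-1 : K) ^ (m * m')) • (gq K n t' s' m' * gq K n t s m)
  | 0 => by rw [gq, one_mul, mul_one, zero_mul, pow_zero, one_smul]
  | m + 1 => by
    rw [gq, mul_assoc, lin_mul_gq, mul_smul_comm, ← mul_assoc, gq_mul_gq_comm t t' s s' m' m, smul_mul_assoc,
      smul_smul, mul_assoc, ← pow_add]
    congr 2
    ring

/-- splitting a product of linear elements. -/
lemma gq_add (t : K) (s m : ℕ) : ∀ m' : ℕ, gq K n t s (m + m') = gq K n t s m * gq K n t (s + m) m'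
  | 0 => by rw [Nat.add_zero, gq, mul_one]
  | m' + 1 => by
    rw [Nat.add_succ, gq, gq_add t s m m', gq, mul_assoc, Nat.add_assoc]

/-! ### Weil side: the two-exponential h-part is `c₁·Π(x_c + λy_c) + c₂·Π(x_c + μy_c)` -/

/-- HankelRank's `w_m` is additive in the coefficient sequence (type `(n,n)` copy). -/
lemma w_add' (m : ℕ) : ∀ q q' : ℕ → K,
    w K (n + n) m (fun k => q k + q' k) = w K (n + n) m q + w K (n + n) m q' := by
  induction m with
  | zero => intro q q'; rw [w, w, w, add_smul]
  | succ m ih =>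
    intro q q'
    have hs : shift K (fun k => q k + q' k) = fun k => shift K q k + shift K q' k := rfl
    rw [w, w, w, hs, ih, ih, add_mul, add_mul]
    abel

/-- HankelRank's `w_m` is homogeneous in the coefficient sequence (type `(n,n)` copy). -/
lemma w_smul' (m : ℕ) (c : K) : ∀ q : ℕ → K, w K (n + n) m (fun k => c * q k) = c • w K (n + n) m q := by
  induction m with
  | zero => intro q; rw [w, w, smul_smul]
  | succ m ih =>
    intro q
    have hs : shift K (fun k => c * q k) = fun k => c * shift K q k := rfl
    rw [w, w, hs, ih, ih, smul_add, smul_mul_assoc, smul_mul_assoc]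

/-- `w_m` of a geometric sequence `t^k` is the ordered product `Π_{c<m}(x_c + t·y_c)`. -/
lemma w_pow (t : K) : ∀ m : ℕ, w K (n + n) m (fun k => t ^ k) = gq K n t 0 m
  | 0 => by rw [w, gq, pow_zero, one_smul]
  | m + 1 => by
    have hs : shift K (fun k => t ^ k) = fun k => t * (fun j => t ^ j) k := by
      funext k; rw [shift_apply, pow_succ, mul_comm]
    rw [w, hs, w_smul', w_pow t m, gq, Nat.zero_add, mul_add, smul_mul_assoc, mul_smul_comm]

/-- the two-exponential h-part. -/
theorem w_twoExp (c₁ c₂ lam mu : K) (m : ℕ) :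
    w K (n + n) m (fun k => c₁ * lam ^ k + c₂ * mu ^ k) = c₁ • gq K n lam 0 m + c₂ • gq K n mu 0 m := by
  have h : (fun k => c₁ * lam ^ k + c₂ * mu ^ k) = fun k => (fun j => c₁ * lam ^ j) k + (fun j => c₂ * mu ^ j) k := rfl
  rw [h, w_add', w_smul', w_smul', w_pow, w_pow]

/-- the four products of the adapted blocks in terms of the class data. -/
lemma gq_A0_C0 (lam : K) : gq K n lam n n * gq K n lam 0 n = ((-1 : K) ^ (n * n)) • gq K n lam 0 (n + n) := by
  rw [gq_add, Nat.zero_add, gq_mul_gq_comm]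

/-- `Π_{c<n}(x_c + μy_c) · Π_{c≥n}(x_c + μy_c) = Π_{c<2n}(x_c + μy_c)`. -/
lemma gq_A1_C1 (mu : K) : gq K n mu 0 n * gq K n mu n n = gq K n mu 0 (n + n) := by
  rw [gq_add, Nat.zero_add]

/-- `Π_{c≥n}(x_c + λy_c) · Π_{c≥n}(x_c + μy_c) = (−1)^{C(n,2)}(μ−λ)ⁿ · Π_{c≥n}(x_c ∧ y_c)`. -/
lemma gq_A0_C1 (lam mu : K) :
    gq K n lam n n * gq K n mu n n = (((-1 : K) ^ (n.choose 2)) * (mu - lam) ^ n) • pp K n n n :=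
  gq_mul_gq_same K lam mu n n

/-- `Π_{c<n}(x_c + μy_c) · Π_{c<n}(x_c + λy_c) = (−1)^{C(n,2)}(λ−μ)ⁿ · Π_{c<n}(x_c ∧ y_c)`. -/
lemma gq_A1_C0 (lam mu : K) :
    gq K n mu 0 n * gq K n lam 0 n = (((-1 : K) ^ (n.choose 2)) * (lam - mu) ^ n) • pp K n 0 n :=
  gq_mul_gq_same K mu lam 0 n

end Summit.Ventures.HSemireg.Wedge.WeilPurity
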